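import Literature.InformationTheory.QuantumCodes.PlanarCodeErasureHalfGeometry
import Literature.Probability.RandomPlanarGeometry.SAWCount
import Mathlib.Combinatorics.SimpleGraph.Paths
import HarnessLib

/-!
# Decoding failure of the PLANAR surface code forces a long, half-faulty rough-to-rough self-avoiding path
# (Dennis–Kitaev–Landahl–Preskill 2002, §5.2–5.3: the coding half of the counting bound, relative version)

Topic `Literature/InformationTheory/QuantumCodes` (venture QEC, LADDER-QEC rung Q5, PARTITION row 09; qec-type-09 gen 6,
cell item 09.PSAW). All PROVED, kernel axioms, no named fact. The planar code is lit-2's `HGP(H, Hᵀ)`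
(`HypergraphProductThresholds.lean`: checks `planarHX k` on the vertices `(a, b) ∈ Fin (k+1) × Fin (k+2)`, qubits
`PlanarQubit k`, trivial errors `planarSZ k`), drawn in `ℤ²` as in type-03's `PlanarCodeErasureHalfGeometry.lean` (vertex
`(a, b) ↦ pv u a b = (a, b) + u`, qubit `q ↦` the bond `qubitEdge u q`, the rough boundaries becoming the rows `-1` and `k+1`).

DKLP §5.3 on planar codes: "To bound the failure probability for a planar code rather than the toric code, we should
count the 'relative polygons' that stretch from one edge of the lattice to the opposite edge. This change has no effect on
the estimate of the threshold." This file makes the CODING half of that remark a theorem: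

* `planarHX_apply_eq_ite` — **incidence is geometry**: `H_X((a,b), q) = 1` iff the site of `(a, b)` is an end of the bond
  of `q`; hence the vertex syndrome of a chain is the parity of its bonds at that site (`planarHX_mulVec_apply_eq_sum`);
* `pathEdge`, `IsCrossing`, `pathQubits` — a ROUGH-TO-ROUGH LATTICE PATH of the patch, coded by its bottom rough site
  `(-1, b₀)` and a vertex function `ω : ℕ → ℤ²` from the origin (the tree's `SAW.Zd.saws 2 n`: `n` nearest-neighbour steps,
  self-avoiding): its `n` bonds are bonds of qubits and it ends on the top rough row `k+1`; `pathQubits` = those `n` qubits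
  (`card_pathQubits`), a chain WITHOUT vertex syndrome (`planarHX_mulVec_pathQubits`: every vertex of the patch is an
  interior point of the path or off it) and with `n ≥ k + 2` (`le_length_of_isCrossing`: the path climbs `k + 2` rows);
* ★ `exists_crossing_subset` — a cycle of the sector (`H_X c = 0`) with an ODD bottom rough crossing contains a
  rough-to-rough self-avoiding path whose qubits lie in any set supporting the cycle (type-03's hand-shaking lemma
  `exists_reachable_top_of_odd` + Mathlib's `Walk.bypass`).

The half-weight inequality, the counting (`≤ (k+2) · cₙ` such paths) and the probabilistic union bound are
`PlanarCodeCrossingPathsBound.lean`.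

## References

* [DennisEtAl2002] E. Dennis, A. Kitaev, A. Landahl, J. Preskill, *Topological quantum memory*, J. Math. Phys. 43 (2002)
  4452–4505, arXiv:quant-ph/0110143, §3.2 (planar codes, rough edges, relative cycles), §5.2 (eq. (e_ineq), `H_m + H_e ≥ H`;
  "homologically nontrivial (self-avoiding) path must contain at least L links"), §5.3 (relative polygons of planar codes).
* [TillichZemor2014] J.-P. Tillich, G. Zémor, IEEE Trans. IT 60 (2014) 1193, §3 (the surface code as `HGP(H, Hᵀ)`).
* [MadrasSlade1993] N. Madras, G. Slade, *The Self-Avoiding Walk*, Birkhäuser 1993, §1.1 (`n`-step self-avoiding walks).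
-/

namespace Literature.InformationTheory.QuantumCodes

namespace PlanarCode

open Finset Matrix
open Literature.Probability.LatticeModels (Site zdGraph zdGraph_adj_iff)
open Literature.Probability.Percolation (BondConfig openGraph openGraph_adj)
open Literature.Probability.RandomPlanarGeometry.SAW.Zd (saws mem_saws abs_apply_le_of_adj zdGraph_adj_iff_sub
  zdGraph_adj_sub_right)

variable {k : ℕ}

/-! ### Sites and bonds -/

/-- Sites of the lift are determined by their coordinates. [folklore] -/
private theorem pv_eq_pv_iff {u : Site 2} {a b a' b' : ℤ} : pv u a b = pv u a' b' ↔ a = a' ∧ b = b' := by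
  refine ⟨fun h => ?_, by rintro ⟨rfl, rfl⟩; rfl⟩
  have h' : (![a, b] : Site 2) = ![a', b'] := add_right_cancel h
  exact ⟨by simpa using congrFun h' 0, by simpa using congrFun h' 1⟩

/-- First coordinate of a site of the lift. [folklore] -/
private theorem pv_apply_zero (u : Site 2) (a b : ℤ) : pv u a b 0 = a + u 0 := by simp [pv]

/-- The two ends of the bond of a qubit are adjacent sites of `ℤ²` (they differ by a unit vector).
[cite: TillichZemor2014, §3 (edges of HGP(H, Hᵀ))] -/
theorem zdGraph_adj_of_mem_qubitEdge (u : Site 2) (q : PlanarQubit k) {p p' : Site 2} (h : qubitEdge u q = s(p, p')) :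
    (zdGraph 2).Adj p p' := by
  have key : ∀ (a b : ℤ) (i : Fin 2), (zdGraph 2).Adj (pv u a b) (pv u a b + Pi.single i 1) := by
    intro a b i
    rw [zdGraph_adj_iff_sub]
    exact ⟨i, Or.inl (by simp)⟩
  have hv : ∀ a b : ℤ, pv u a b + Pi.single 0 1 = pv u (a + 1) b := by
    intro a b
    funext j
    fin_cases j
    · simp [pv, Matrix.vecHead, Matrix.vecTail]
      ring
    · simp [pv, Matrix.vecHead, Matrix.vecTail]
  have hh : ∀ a b : ℤ, pv u a b + Pi.single 1 1 = pv u a (b + 1) := by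
    intro a b
    funext j
    fin_cases j
    · simp [pv, Matrix.vecHead, Matrix.vecTail]
    · simp [pv, Matrix.vecHead, Matrix.vecTail]
      ring
  rcases q with ⟨α, b⟩ | ⟨a, β⟩
  · have hA := key (((α : ℕ) : ℤ) - 1) b 0
    rw [hv, sub_add_cancel] at hA
    simp only [qubitEdge, Sum.elim_inl, Sym2.eq_iff] at h
    rcases h with ⟨rfl, rfl⟩ | ⟨rfl, rfl⟩
    · exact hA
    · exact hA.symm
  · have hA := key a β 1
    rw [hh] at hA
    simp only [qubitEdge, Sum.elim_inr, Sym2.eq_iff] at h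
    rcases h with ⟨rfl, rfl⟩ | ⟨rfl, rfl⟩
    · exact hA
    · exact hA.symm

/-- **The bond map `q ↦ qubitEdge u q` is injective**: a qubit of the planar code is determined by the bond it carries
(vertical bonds = left qubits, horizontal bonds = right qubits). [cite: TillichZemor2014, §3 (edges of HGP(H, Hᵀ))] -/
theorem qubitEdge_injective (u : Site 2) : Function.Injective (qubitEdge (k := k) u) := by
  rintro (⟨α, b⟩ | ⟨a, β⟩) (⟨α', b'⟩ | ⟨a', β'⟩) h <;>
    simp only [qubitEdge, Sum.elim_inl, Sum.elim_inr, Sym2.eq_iff, pv_eq_pv_iff, Sum.inl.injEq, Sum.inr.injEq,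
      Prod.mk.injEq, Fin.ext_iff, reduceCtorEq] at h ⊢ <;> omega

/-! ### Incidence is geometry -/

/-- **`H_X((a,b), q) = [the site of (a,b) is an end of the bond of q]`**: the vertex `(a, b)` of the planar code lies on the
left qubit `(α, b')` iff `b' = b` and `α ∈ {a, a+1}` (the bond `{(α-1, b'), (α, b')}`), and on the right qubit `(a', β)` iff
`a' = a` and `b ∈ {β, β+1}` (the bond `{(a', β), (a', β+1)}`). [cite: TillichZemor2014, §3 (vertex–edge incidences of HGP(H, Hᵀ))] -/
theorem planarHX_apply_eq_ite (u : Site 2) (a : Fin (k + 1)) (b : Fin (k + 2)) (q : PlanarQubit k) :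
    planarHX k (a, b) q = if pv u a b ∈ qubitEdge u q then 1 else 0 := by
  classical
  rcases q with ⟨α, b'⟩ | ⟨a', β⟩
  · have key : pv u a b ∈ qubitEdge u (Sum.inl (α, b') : PlanarQubit k) ↔ (α = a.castSucc ∨ α = a.succ) ∧ b = b' := by
      simp only [qubitEdge, Sum.elim_inl, Sym2.mem_iff, pv_eq_pv_iff, Fin.ext_iff, Fin.val_castSucc, Fin.val_succ]
      omega
    rw [planarHX, HypergraphProduct.xMatrix_apply_inl]
    simp only [repMatrix, Matrix.of_apply, key]
    by_cases hA : (α = a.castSucc ∨ α = a.succ) <;> by_cases hB : b = b' <;> simp [hA, hB]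
  · have key : pv u a b ∈ qubitEdge u (Sum.inr (a', β) : PlanarQubit k) ↔ a = a' ∧ (b = β.castSucc ∨ b = β.succ) := by
      simp only [qubitEdge, Sum.elim_inr, Sym2.mem_iff, pv_eq_pv_iff, Fin.ext_iff, Fin.val_castSucc, Fin.val_succ]
      omega
    rw [planarHX, HypergraphProduct.xMatrix_apply_inr]
    simp only [repMatrix, Matrix.transpose_apply, Matrix.of_apply, key]
    by_cases hA : a = a' <;> by_cases hB : (b = β.castSucc ∨ b = β.succ) <;> simp [hA, hB]

/-- **The vertex syndrome is the parity of the chain on the bonds at that site**: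
`(H_X x)(a,b) = Σ_{q : (a,b) ∈ bond(q)} x(q)`. [cite: DennisEtAl2002, §3.2 (site defects at the ends of error chains)] -/
theorem planarHX_mulVec_apply_eq_sum (u : Site 2) (x : PlanarQubit k → ZMod 2) (a : Fin (k + 1)) (b : Fin (k + 2)) :
    (planarHX k *ᵥ x) (a, b) = ∑ q, if pv u a b ∈ qubitEdge u q then x q else 0 := by
  classical
  simp only [mulVec, dotProduct, planarHX_apply_eq_ite u]
  exact Finset.sum_congr rfl fun q _ => by split_ifs <;> simp

/-! ### Rough-to-rough lattice paths of the patch -/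

/-- The `i`-th bond `{s + ω(i), s + ω(i+1)}` of the lattice path that starts at the bottom rough site `s = (-1, b₀)` and
follows the vertex function `ω` (`ω(0) = 0`). [cite: DennisEtAl2002, §5.3 (relative polygons with endpoints on the boundary)] -/
def pathEdge (b₀ : Fin (k + 2)) (ω : ℕ → Site 2) (i : ℕ) : Sym2 (Site 2) :=
  s(pv 0 (-1) b₀ + ω i, pv 0 (-1) b₀ + ω (i + 1))

/-- **A rough-to-rough path of the `k`-th planar patch** (`n` steps, bottom site `(-1, b₀)`, vertex function `ω`): each of
its `n` bonds is the bond of a qubit, and it ends on the top rough row `k + 1`.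
[cite: DennisEtAl2002, §5.3 (homologically nontrivial relative polygon, endpoints on the boundary)] -/
def IsCrossing (k : ℕ) (b₀ : Fin (k + 2)) (n : ℕ) (ω : ℕ → Site 2) : Prop :=
  (∀ i < n, ∃ q : PlanarQubit k, qubitEdge 0 q = pathEdge b₀ ω i) ∧
    ∃ b₁ : Fin (k + 2), pv 0 (-1) b₀ + ω n = pv 0 ((k : ℤ) + 1) b₁

open Classical in
/-- The qubits whose bonds are the first `n` bonds of the path `(b₀, ω)`. [cite: DennisEtAl2002, §5.2 (the links of the path)] -/
noncomputable def pathQubits (b₀ : Fin (k + 2)) (n : ℕ) (ω : ℕ → Site 2) : Finset (PlanarQubit k) :=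
  univ.filter fun q => ∃ i < n, qubitEdge 0 q = pathEdge b₀ ω i

/-- The bonds of a self-avoiding path are pairwise distinct. [cite: MadrasSlade1993, §1.1] -/
theorem pathEdge_injOn {n : ℕ} {ω : ℕ → Site 2} (hω : ω ∈ saws 2 n) (b₀ : Fin (k + 2)) :
    Set.InjOn (pathEdge b₀ ω) (Finset.range n : Set ℕ) := by
  obtain ⟨-, -, -, hinj⟩ := mem_saws.1 hω
  intro i hi j hj h
  simp only [Finset.coe_range, Set.mem_Iio] at hi hj
  simp only [pathEdge, Sym2.eq_iff, add_right_inj] at h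
  rcases h with ⟨h1, -⟩ | ⟨h1, h2⟩
  · exact hinj (show i ≤ n by omega) (show j ≤ n by omega) h1
  · have hi' := hinj (show i ≤ n by omega) (show j + 1 ≤ n by omega) h1
    have hj' := hinj (show i + 1 ≤ n by omega) (show j ≤ n by omega) h2
    omega

open Classical in
/-- The bond map carries `pathQubits` onto the set of bonds of the path.
[cite: DennisEtAl2002, §5.2 (the links of the path)] -/
theorem image_qubitEdge_pathQubits {b₀ : Fin (k + 2)} {n : ℕ} {ω : ℕ → Site 2} (hX : IsCrossing k b₀ n ω) :
    (pathQubits b₀ n ω).image (qubitEdge 0) = (Finset.range n).image (pathEdge b₀ ω) := by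
  ext e
  simp only [Finset.mem_image, pathQubits, Finset.mem_filter, Finset.mem_univ, true_and, Finset.mem_range]
  constructor
  · rintro ⟨q, ⟨i, hi, hq⟩, rfl⟩
    exact ⟨i, hi, hq.symm⟩
  · rintro ⟨i, hi, rfl⟩
    obtain ⟨q, hq⟩ := hX.1 i hi
    exact ⟨q, ⟨i, hi, hq⟩, hq⟩

open Classical in
/-- **A crossing self-avoiding path with `n` steps uses exactly `n` qubits.** [cite: DennisEtAl2002, §5.2 (H links)] -/
theorem card_pathQubits {b₀ : Fin (k + 2)} {n : ℕ} {ω : ℕ → Site 2} (hω : ω ∈ saws 2 n) (hX : IsCrossing k b₀ n ω) :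
    (pathQubits b₀ n ω).card = n := by
  rw [← Finset.card_image_of_injective (pathQubits b₀ n ω) (qubitEdge_injective 0), image_qubitEdge_pathQubits hX,
    Finset.card_image_of_injOn (pathEdge_injOn hω b₀), Finset.card_range]

open Classical in
/-- Sums over the qubits of the path are sums over its bonds. [cite: DennisEtAl2002, §5.2 (the links of the path)] -/
theorem sum_pathQubits_eq {M : Type*} [AddCommMonoid M] {b₀ : Fin (k + 2)} {n : ℕ} {ω : ℕ → Site 2}
    (hω : ω ∈ saws 2 n) (hX : IsCrossing k b₀ n ω) (g : Sym2 (Site 2) → M) :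
    ∑ q ∈ pathQubits b₀ n ω, g (qubitEdge 0 q) = ∑ i ∈ Finset.range n, g (pathEdge b₀ ω i) := by
  rw [← Finset.sum_image (fun q _ q' _ h => qubitEdge_injective 0 h), image_qubitEdge_pathQubits hX,
    Finset.sum_image (pathEdge_injOn hω b₀)]

/-- Telescoping modulo `2`: `Σ_{i<n} (f(i) + f(i+1)) = f(0) + f(n)` in `ℤ₂`. [folklore] -/
private theorem sum_range_add_succ_eq (f : ℕ → ZMod 2) (n : ℕ) :
    ∑ i ∈ Finset.range n, (f i + f (i + 1)) = f 0 + f n := by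
  have h2 : ∀ x : ZMod 2, x + x = 0 := by decide
  induction n with
  | zero => rw [Finset.sum_range_zero, h2]
  | succ n ih =>
    rw [Finset.sum_range_succ, ih]
    calc f 0 + f n + (f n + f (n + 1)) = f 0 + f (n + 1) + (f n + f n) := by ring
      _ = f 0 + f (n + 1) := by rw [h2, add_zero]

/-- **A rough-to-rough path carries no vertex syndrome**: `H_X 𝟙_P = 0` for the qubit set `P` of a crossing self-avoiding
path — every vertex of the patch is met by `0` or `2` of its bonds (its two ends lie on the rough rows `-1` and `k+1`, which
carry no check), so flipping a chain along `P` does not change its syndrome.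
[cite: DennisEtAl2002, §3.2 (a relative 1-cycle ending on the rough edges has no boundary at the sites)] -/
theorem planarHX_mulVec_pathQubits {b₀ : Fin (k + 2)} {n : ℕ} {ω : ℕ → Site 2} (hω : ω ∈ saws 2 n)
    (hX : IsCrossing k b₀ n ω) {χ : PlanarQubit k → ZMod 2} (hχ : ∀ q, χ q = if q ∈ pathQubits b₀ n ω then 1 else 0) :
    planarHX k *ᵥ χ = 0 := by
  classical
  obtain ⟨h0, -, hadj, -⟩ := mem_saws.1 hω
  obtain ⟨b₁, hb₁⟩ := hX.2
  funext ⟨a, b⟩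
  rw [Pi.zero_apply, planarHX_mulVec_apply_eq_sum 0]
  set v : Site 2 := pv 0 a b with hv
  set f : ℕ → ZMod 2 := fun i => if v = pv 0 (-1) b₀ + ω i then 1 else 0 with hf
  -- the syndrome is the number of bonds of the path at `v`, i.e. `Σ_{i<n} ([v = ωᵢ] + [v = ωᵢ₊₁]) = [v = ω₀] + [v = ωₙ]`
  have h1 : (∑ q, if v ∈ qubitEdge 0 q then χ q else 0) =
      ∑ q ∈ pathQubits b₀ n ω, if v ∈ qubitEdge 0 q then (1 : ZMod 2) else 0 := by
    rw [← Fintype.sum_extend_by_zero (pathQubits b₀ n ω)]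
    refine Finset.sum_congr rfl fun q _ => ?_
    rw [hχ q]
    split_ifs <;> rfl
  have h2 : ∀ i ∈ Finset.range n, (if v ∈ pathEdge b₀ ω i then (1 : ZMod 2) else 0) = f i + f (i + 1) := by
    intro i hi
    rw [Finset.mem_range] at hi
    have hne : pv 0 (-1) b₀ + ω i ≠ pv 0 (-1) b₀ + ω (i + 1) := fun h => (hadj i hi).ne (add_left_cancel h)
    simp only [pathEdge, Sym2.mem_iff, hf]
    by_cases hA : v = pv 0 (-1) b₀ + ω i
    · have hB : v ≠ pv 0 (-1) b₀ + ω (i + 1) := fun h => hne (hA.symm.trans h)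
      rw [if_pos (Or.inl hA), if_pos hA, if_neg hB, add_zero]
    · by_cases hB : v = pv 0 (-1) b₀ + ω (i + 1)
      · rw [if_pos (Or.inr hB), if_neg hA, if_pos hB, zero_add]
      · rw [if_neg (not_or.2 ⟨hA, hB⟩), if_neg hA, if_neg hB, add_zero]
  have h3 : f 0 = 0 := by
    simp only [hf, h0, add_zero, hv]
    rw [if_neg]
    intro h
    have := (pv_eq_pv_iff.1 h).1
    omega
  have h4 : f n = 0 := by
    simp only [hf, hb₁, hv]
    rw [if_neg]
    intro h
    have := (pv_eq_pv_iff.1 h).1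
    have := a.2
    omega
  rw [h1, sum_pathQubits_eq hω hX (fun e => if v ∈ e then (1 : ZMod 2) else 0), Finset.sum_congr rfl h2,
    sum_range_add_succ_eq, h3, h4, add_zero]

/-- **A rough-to-rough path has at least `k + 2` bonds**: it climbs from row `-1` to row `k + 1` one unit at a time
("the homologically nontrivial (self-avoiding) path must contain at least L links").
[cite: DennisEtAl2002, §5.2 (before eq. (saw_L))] -/
theorem le_length_of_isCrossing {b₀ : Fin (k + 2)} {n : ℕ} {ω : ℕ → Site 2} (hω : ω ∈ saws 2 n)
    (hX : IsCrossing k b₀ n ω) : k + 2 ≤ n := by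
  obtain ⟨h0, -, hadj, -⟩ := mem_saws.1 hω
  obtain ⟨b₁, hb₁⟩ := hX.2
  have hb := abs_apply_le_of_adj h0 hadj n le_rfl 0
  have hc := congrFun hb₁ 0
  rw [Pi.add_apply, pv_apply_zero, pv_apply_zero] at hc
  have hωn : ω n 0 = (k : ℤ) + 2 := by linarith
  rw [hωn] at hb
  have := le_of_abs_le hb
  omega

/-! ### Extraction: an odd crossing contains a rough-to-rough self-avoiding path -/

/-- **A cycle of the sector with an odd bottom rough crossing contains a rough-to-rough self-avoiding path** whose
qubits lie in any set `Er` supporting the cycle: type-03's hand-shaking lemma (`exists_reachable_top_of_odd`) joins a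
bottom rough site to a top rough site through bonds of `Er`; removing its loops leaves a self-avoiding walk (Mathlib's
`Walk.bypass`), which read from its start is an `n`-step self-avoiding walk of `ℤ²` (the tree's `SAW.Zd.saws 2 n`).
[cite: DennisEtAl2002, §5.3 (relative polygon whose endpoints lie on the boundary)] -/
theorem exists_crossing_subset {Er : Finset (PlanarQubit k)} {c : PlanarQubit k → ZMod 2} (hc : planarHX k *ᵥ c = 0)
    (hcE : ∀ q, c q ≠ 0 → q ∈ Er) (hodd : ∑ b : Fin (k + 2), c (Sum.inl (0, b)) = 1) :
    ∃ (b₀ : Fin (k + 2)) (n : ℕ) (ω : ℕ → Site 2), ω ∈ saws 2 n ∧ IsCrossing k b₀ n ω ∧ pathQubits b₀ n ω ⊆ Er := by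
  classical
  obtain ⟨b₀, b₁, hreach⟩ := exists_reachable_top_of_odd 0 hc hcE hodd
  obtain ⟨W⟩ := hreach
  set s : Site 2 := pv 0 (-1) b₀ with hs
  set t : Site 2 := pv 0 ((k : ℤ) + 1) b₁ with ht
  set P : (openGraph (planarLift 0 Er)).Walk s t := W.bypass with hP
  have hpath : P.IsPath := W.bypass_isPath
  set n := P.length with hn
  set ω : ℕ → Site 2 := fun i => P.getVert i - s with hω
  have hωs : ∀ i, s + ω i = P.getVert i := fun i => by
    simp only [hω]; abel
  -- each step of the walk is an open bond of the lift, i.e. the bond of a qubit of `Er`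
  have hstep : ∀ i < n, ∃ q ∈ Er, qubitEdge 0 q = pathEdge b₀ ω i := by
    intro i hi
    have hA := P.adj_getVert_succ hi
    rw [openGraph_adj] at hA
    obtain ⟨⟨q, hq, hqe⟩, -⟩ := hA
    refine ⟨q, hq, ?_⟩
    rw [hqe, pathEdge, ← hs, hωs, hωs]
  refine ⟨b₀, n, ω, ?_, ⟨fun i hi => ?_, b₁, ?_⟩, fun q hq => ?_⟩
  · -- `ω` is an `n`-step self-avoiding walk from the origin
    refine mem_saws.2 ⟨by simp [hω], fun i hi => ?_, fun i hi => ?_, fun i hi j hj hij => ?_⟩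
    · simp only [hω]
      rw [P.getVert_of_length_le hi, P.getVert_length]
    · obtain ⟨q, -, hq⟩ := hstep i hi
      have hA := zdGraph_adj_of_mem_qubitEdge 0 q hq
      rwa [← zdGraph_adj_sub_right _ _ s, add_sub_cancel_left, add_sub_cancel_left] at hA
    · exact hpath.getVert_injOn hi hj (sub_left_injective hij)
  · obtain ⟨q, -, hq⟩ := hstep i hi
    exact ⟨q, hq⟩
  · rw [hωs, P.getVert_of_length_le le_rfl]
  · rw [pathQubits, Finset.mem_filter] at hq
    obtain ⟨i, hi, hqi⟩ := hq.2
    obtain ⟨q', hq', hq'i⟩ := hstep i hi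
    rwa [← qubitEdge_injective 0 (hqi.trans hq'i.symm)] at hq'

end PlanarCode

end Literature.InformationTheory.QuantumCodes
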